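/-
Copyright (c) 2026 the pub-hodgecm-mathlib formalisation cell (harness21).  Prover seat hodgecm-mathlib-LH5-p05 (g12), 2026-09-03.  E1 row 55 file A-II «HOROSPHERE
TRANSVERSAL» (census CENSUS-R55 v1 (LH10-p02 (g14)) §3 (H5)–(H8); keeper ∕ dealer F0P3a-p03 (g30) k29 split A-I ∕ A-II ∕ B).
-/
import Literature.NumberTheory.Automorphic.UnitaryLatticeTreeHorocycleSteps                    -- A-I (LH10-p02 (g14)): (H1) `exists_forall_le_latticeGraphIso_apartmentEnum_eq_self_of_mem_unipotentU`, (H4) `eq_apartmentEnum_sub_one_or_exists_mem_unipotentU_of_adj`; brings A-I-1 `…HorocycleRootStar` ((T) `exists_mem_torusU_latticeGraphIso_apartmentEnum_eq_add`, (T′) `latticeGraphIso_apartmentEnum_eq_self_of_unit_diagonal`) and ★ 39γ `…GeodesicApartment` (`dist_apartmentEnum`, `dist_latticeGraphIso_apartmentEnum`, `latticeGraph_adj_apartmentEnum_succ`, `isTree_latticeGraph_three_of_unramified`)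
import Literature.NumberTheory.Automorphic.UnitaryLatticeTreeFixedChildCountTransportRamified   -- ★ `latticeGraphIso_one_apply`, `latticeGraphIso_mul_apply`, `latticeGraphIso_inv_mul_apply`, `latticeGraphIso_mul_inv_apply` (any `N`, any form)
import Literature.NumberTheory.Automorphic.UnitaryGroupBorelInduction                          -- ★ `UnitaryGroup.borelU ∕ torusU ∕ unipotentU`, `isComplement'_torusU_unipotentU`, `borelU_le_normalizer`, `mem_torusU_iff_mem_torusOfForm` (+ ★ `mem_torusOfForm_iff`)
import HarnessLib

/-!
# The lattice tree of the unramified `U(3)`: THE `N`-ORBITS ARE THE HOROSPHERES AND THE STANDARD APARTMENT IS A TRANSVERSAL (Bruhat–Tits 1972 §10; Serre, *Trees* II.1.1)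

Topic `NumberTheory/Automorphic`; namespace `Literature.NumberTheory.Automorphic.UnitaryLatticeTree` (T1a currency of ★ `UnitaryLatticeTreeDefs`).  THEOREMS ONLY (no
definition, no instance, no notation, no named fact, no `sorry`).  Cell `pub/hodgecm-mathlib` (D-0151), crux H413 = `stmt-HodgeConjecture-24833`; E1 row 55 «HOROCYCLE ∕
HEIGHT GEOMETRY OF THE `U(3)` TREE AT THE DATUM», census `F0/P3c/LH10/LH10-p02/g14/r55/CENSUS-R55.v1.LH10p02g14.md` §3: file A-II = heads (H5)–(H8) over file A-I
(★ `UnitaryLatticeTreeHorocycleSteps`, LH10-p02 (g14): the torus translations (T)∕(T′), «`N` fixes the end `A(−∞)`» (H1) and the STAR DICHOTOMY (H4) at every apartment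
vertex).  Consumers: the Jacquet-module ∕ Euler–Poincaré bookkeeping of the Schneider–Stuhler resolution at the datum (★ `JacquetModuleBlockPermutation` ∕
`JacquetEulerBlockPermutation` `section Torus`∕`Euler` letters `rep tr htrN hrepR htr hrep_act hrep_id ht hsh`, ★ `SchneiderStuhlerEPInducedTraceMackey` §5 `hT hdec`), via the
datum file B `Theorems/F0P3cStCharTSHorocyclesAtDatum`.  HONEST LABEL: count-neutral lattice-model base layer ((R-SS) engine not chartered beyond PAYDOWN-UNR for K1);
HC_CM is proved only modulo the 2 remaining named inputs (hLiu418 24832, h413 24833) until rung 0 closes; nothing printed is asserted here.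

THE MATHEMATICS.  `J₀ = antidiag(1,1,1)`, `hd : UnramifiedLocalConjDatum σ ϖ`, `U = U(σ, J₀)`, `B = T N` its upper-triangular Borel subgroup (`T` diagonal, `N` upper
unitriangular, ★ `UnitaryGroupBorelInduction`), `X` the lattice tree (★ `isTree_latticeGraph_three_of_unramified`), `A : ℤ → X` the enumerated standard apartment of ★ 39γ
(`A(2a) = L_a`, `A(2a+1) = L′_{a+1}`, hypothesis-style `(A) (hA0) (hA1)`).  `N` fixes the end `A(−∞)` of the apartment, so its orbits are the HOROSPHERES centred at that end,
and the apartment is a geodesic from that end: it meets every horosphere exactly once.  Precisely: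
* (H5) every vertex is `n · A j` for some `n ∈ N`, `j ∈ ℤ` — induction on the length of a walk from an apartment vertex: by the star dichotomy (H4) a neighbour of `A j` is
  `A (j−1)` or `n · A (j+1)` with `n ∈ N ∩ Stab(A j)`;
* (H6) the index `j` is unique: if `n · A i = A j` then, `n` fixing `A k` for `k ≪ 0` (H1), `|j − k| = d(A k, A j) = d(n·A k, n·A i) = d(A k, A i) = |i − k|`;
* (H7) every edge is `n · {A j, A (j+1)}` for a unique `j` ((H5) at one end, (H4) at the other; (H6) twice);
* (H8) every `t ∈ T` is `diag(d)` with `|d₀| = q^{c}`-scaled: `|d₀| = exp(−c)`, `|d₁| = 1`, `|d₂| = exp c`, and translates the apartment by `2c` (it is a unit-diagonal element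
  times the translation `t_{c}` of (T)); hence a Borel element `b = t n` fixing one apartment vertex has `t` unit-diagonal (fixing the whole apartment) and `n ∈ N ∩ Stab`
  («`B ∩ Stab(A j) = (T ∩ K) · (N ∩ Stab(A j))`»), and in general `b · A j = n′ · A (j + 2c)` («the `B`-orbits on vertices are the height fibres of a given parity»).
This is the rank-one picture of [BruhatTits1972] §10 ∕ (7.4.18) and of [Serre1980Trees] Ch. II §1.1 (the tree of `SL₂`: the classes `Λ_n` on a horocycle, the action of
the upper-triangular group on the straight path of diagonal lattices), written for the quasi-split `U(3)` lattice model; every statement below is proved from the tree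
axioms of ★ 39γ and the four A-I heads, no printed statement is asserted.

WHAT IS FORMALISED (common binders ★ 39γ `section Enum` verbatim: `(hd) (A) (hA0) (hA1)`; `n · x := latticeGraphIso σ ϖ J₀ n x`).
* §1 (H5) `exists_mem_unipotentU_latticeGraphIso_apartmentEnum_eq` (`∃ n ∈ N, ∃ j, n · A j = x`).
* §2 (H6) `eq_of_mem_unipotentU_of_latticeGraphIso_apartmentEnum_eq` (`n · A i = A j ⇒ i = j`), `…_eq₂` (`n · A i = n′ · A j ⇒ i = j`),
  `existsUnique_apartmentEnum_index` (`∃! j, ∃ n ∈ N, n · A j = x`).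
* §3 (H7) `exists_mem_unipotentU_latticeGraphIso_apartmentEnum_eq_of_adj` (oriented), `exists_mem_unipotentU_sym2Map_apartmentEnum_eq_of_adj` (`Sym2`),
  `exists_mem_unipotentU_mapEdgeSet_apartmentEnum_eq` (`edgeSet`, the consumers' `act₁ g := (latticeGraphIso … g).mapEdgeSet`); uniqueness
  `eq_of_mem_unipotentU_of_sym2Map_apartmentEnum_eq`, `…_eq₂`, `eq_of_mem_unipotentU_of_mapEdgeSet_apartmentEnum_eq`.
* §4 (H8) `exists_forall_latticeGraphIso_apartmentEnum_eq_add_of_mem_torusU` (torus normal form on the apartment), `mem_unitaryInt_of_glDiagonal_eq_of_v_eq_one`,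
  `exists_torusU_mul_unipotentU_of_mem_borelU_of_latticeGraphIso_apartmentEnum_eq` (Borel stabilisers), `exists_mem_unipotentU_latticeGraphIso_apartmentEnum_eq_of_mem_borelU`
  (`B`-orbits = height fibres).

## References
* [BruhatTits1972] F. Bruhat, J. Tits, *Groupes réductifs sur un corps local I*, Publ. Math. IHÉS 41 (1972), §10 (lattice models of the classical groups), (7.4.18).
* [Serre1980Trees] J.-P. Serre, *Trees* (1980), Ch. II §1.1 (the tree of `SL₂` over a local field: lattice classes, the straight path of diagonal lattices, stabilisers),
  Ch. I §2.2 Prop. 8 (geodesics in a tree), Ch. I §6.4 (translations along an axis).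
-/

set_option autoImplicit false

noncomputable section

open scoped Valued WithZero Matrix MatrixGroups

namespace Literature.NumberTheory.Automorphic.UnitaryLatticeTree

open _root_.SimpleGraph Literature.NumberTheory.Automorphic Literature.NumberTheory.Automorphic.HermitianLattice
open Literature.NumberTheory.Automorphic.UnitaryGroup
open Literature.Combinatorics.SimpleGraph

variable {K : Type*} [Field K] [Valued K ℤᵐ⁰] {σ : K →+* K} {ϖ : K}

section Enum

variable (hd : UnramifiedLocalConjDatum σ ϖ)
  (A : ℤ → {M : Submodule 𝒪[K] (Fin 3 → K) // IsVertex σ ϖ ((StdForm.antidiagonal 3).over K) M})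
  (hA0 : ∀ a : ℤ, (A (2 * a)).1 = latt (Matrix.diagonal ![ϖ ^ a, (1 : K), ϖ ^ (-a)]))
  (hA1 : ∀ a : ℤ, (A (2 * a + 1)).1 = latt (Matrix.diagonal ![ϖ ^ (a + 1), (1 : K), ϖ ^ (-a)]))
include hd hA0 hA1

/-! ## §1 (H5) EXISTENCE: every vertex lies on an `N`-translate of the standard apartment -/

/-- **(H5) EVERY VERTEX IS `n · A j` FOR SOME `n ∈ N` AND `j ∈ ℤ`** — the standard apartment meets every `N`-orbit (horosphere).  Induction on the length of a
walk from an apartment vertex `A j` to `x` (the tree is connected, ★ `isTree_latticeGraph_three_of_unramified`): by the star dichotomy (H4) the first step `y` is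
either `A (j − 1)` (a shorter walk from an apartment vertex) or `n · A (j + 1)` with `n ∈ N` fixing `A j` (transport the rest of the walk by `n⁻¹`).
[cite: BruhatTits1972, §10] [cite: Serre1980Trees, II.1.1] -/
theorem exists_mem_unipotentU_latticeGraphIso_apartmentEnum_eq
    (x : {M : Submodule 𝒪[K] (Fin 3 → K) // IsVertex σ ϖ ((StdForm.antidiagonal 3).over K) M}) :
    ∃ n : unitaryGroupOfForm σ ((StdForm.antidiagonal 3).over K), n ∈ unipotentU σ ((StdForm.antidiagonal 3).over K) ∧
      ∃ j : ℤ, latticeGraphIso σ ϖ ((StdForm.antidiagonal 3).over K) n (A j) = x := by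
  have key : ∀ (ℓ : ℕ) (j : ℤ) (x : {M : Submodule 𝒪[K] (Fin 3 → K) // IsVertex σ ϖ ((StdForm.antidiagonal 3).over K) M})
      (p : (latticeGraph σ ϖ ((StdForm.antidiagonal 3).over K)).Walk (A j) x), p.length = ℓ →
      ∃ n : unitaryGroupOfForm σ ((StdForm.antidiagonal 3).over K), n ∈ unipotentU σ ((StdForm.antidiagonal 3).over K) ∧
        ∃ i : ℤ, latticeGraphIso σ ϖ ((StdForm.antidiagonal 3).over K) n (A i) = x := by
    intro ℓ
    induction ℓ with
    | zero =>
      intro j x p hp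
      exact ⟨1, one_mem _, j, by rw [latticeGraphIso_one_apply]; exact Walk.eq_of_length_eq_zero hp⟩
    | succ ℓ ih =>
      intro j x p hp
      cases p with
      | nil => exact absurd hp (by simp)
      | cons hadj q =>
        rename_i y
        rw [Walk.length_cons] at hp
        have hq : q.length = ℓ := by omega
        rcases eq_apartmentEnum_sub_one_or_exists_mem_unipotentU_of_adj hd A hA0 hA1 j hadj with rfl | ⟨n, hn, -, hny⟩
        · exact ih (j - 1) x q hq
        · have hy' : latticeGraphIso σ ϖ ((StdForm.antidiagonal 3).over K) n⁻¹ y = A (j + 1) := by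
            rw [← hny, latticeGraphIso_inv_mul_apply]
          obtain ⟨n', hn', i, hi⟩ := ih (j + 1) (latticeGraphIso σ ϖ ((StdForm.antidiagonal 3).over K) n⁻¹ x)
            ((q.map (latticeGraphIso σ ϖ ((StdForm.antidiagonal 3).over K) n⁻¹).toHom).copy hy' rfl)
            (by rw [Walk.length_copy, Walk.length_map]; exact hq)
          refine ⟨n * n', mul_mem hn hn', i, ?_⟩
          rw [latticeGraphIso_mul_apply, hi, latticeGraphIso_mul_inv_apply]
  obtain ⟨p⟩ := (isTree_latticeGraph_three_of_unramified hd).connected.preconnected (A 0) x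
  exact key _ 0 x p rfl

/-! ## §2 (H6) UNIQUENESS: the apartment index of a horosphere is well defined -/

/-- **(H6) `n · A i = A j` WITH `n ∈ N` FORCES `i = j`** — an `N`-orbit meets the standard apartment in at most one vertex.  Metric proof: by (H1) `n` fixes `A k` for some
`k ≤ min i j`, so `|j − k| = dist (A k) (A j) = dist (n·A k) (n·A i) = dist (A k) (A i) = |i − k|` (★ `dist_latticeGraphIso_apartmentEnum`, ★ `dist_apartmentEnum`).
[cite: BruhatTits1972, §10] [cite: Serre1980Trees, II.1.1; I.2.2 Prop. 8] -/
theorem eq_of_mem_unipotentU_of_latticeGraphIso_apartmentEnum_eq {n : unitaryGroupOfForm σ ((StdForm.antidiagonal 3).over K)}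
    (hn : n ∈ unipotentU σ ((StdForm.antidiagonal 3).over K)) {i j : ℤ} (h : latticeGraphIso σ ϖ ((StdForm.antidiagonal 3).over K) n (A i) = A j) :
    i = j := by
  obtain ⟨j₀, hj₀⟩ := exists_forall_le_latticeGraphIso_apartmentEnum_eq_self_of_mem_unipotentU hd A hA0 hA1 hn
  have hki : min j₀ (min i j) ≤ i := (min_le_right _ _).trans (min_le_left _ _)
  have hkj : min j₀ (min i j) ≤ j := (min_le_right _ _).trans (min_le_right _ _)
  have hfix := hj₀ (min j₀ (min i j)) (min_le_left _ _)
  have h1 := dist_latticeGraphIso_apartmentEnum hd A hA0 hA1 n (min j₀ (min i j)) i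
  rw [hfix, h, dist_apartmentEnum hd A hA0 hA1] at h1
  omega

/-- **(H6₂) two-element form**: `n · A i = n′ · A j` with `n, n′ ∈ N` forces `i = j`. [cite: BruhatTits1972, §10] [cite: Serre1980Trees, II.1.1] -/
theorem eq_of_mem_unipotentU_of_latticeGraphIso_apartmentEnum_eq₂ {n n' : unitaryGroupOfForm σ ((StdForm.antidiagonal 3).over K)}
    (hn : n ∈ unipotentU σ ((StdForm.antidiagonal 3).over K)) (hn' : n' ∈ unipotentU σ ((StdForm.antidiagonal 3).over K)) {i j : ℤ}
    (h : latticeGraphIso σ ϖ ((StdForm.antidiagonal 3).over K) n (A i) = latticeGraphIso σ ϖ ((StdForm.antidiagonal 3).over K) n' (A j)) : i = j :=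
  eq_of_mem_unipotentU_of_latticeGraphIso_apartmentEnum_eq hd A hA0 hA1 (n := n'⁻¹ * n) (mul_mem (inv_mem hn') hn)
    (by rw [latticeGraphIso_mul_apply, h, latticeGraphIso_inv_mul_apply])

/-- **(H6!) THE APARTMENT INDEX OF A VERTEX**: there is a unique `j : ℤ` with `x ∈ N · A j` (existence (H5), uniqueness (H6₂)) — the horosphere ∕ «height» of `x` with
respect to the end fixed by `B`. [cite: BruhatTits1972, §10] [cite: Serre1980Trees, II.1.1] -/
theorem existsUnique_apartmentEnum_index (x : {M : Submodule 𝒪[K] (Fin 3 → K) // IsVertex σ ϖ ((StdForm.antidiagonal 3).over K) M}) :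
    ∃! j : ℤ, ∃ n : unitaryGroupOfForm σ ((StdForm.antidiagonal 3).over K), n ∈ unipotentU σ ((StdForm.antidiagonal 3).over K) ∧
      latticeGraphIso σ ϖ ((StdForm.antidiagonal 3).over K) n (A j) = x := by
  obtain ⟨n, hn, j, hj⟩ := exists_mem_unipotentU_latticeGraphIso_apartmentEnum_eq hd A hA0 hA1 x
  refine ⟨j, ⟨n, hn, hj⟩, ?_⟩
  rintro j' ⟨n', hn', hj'⟩
  exact eq_of_mem_unipotentU_of_latticeGraphIso_apartmentEnum_eq₂ hd A hA0 hA1 hn' hn (hj'.trans hj.symm)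

/-! ## §3 (H7) EDGES: every edge is an `N`-translate of a unique apartment edge `{A j, A (j+1)}` -/

/-- **(H7) EVERY EDGE IS `n · {A j, A (j+1)}`**, oriented form: for `x ~ y` there are `n ∈ N` and `j` with `(x, y) = (n·A j, n·A (j+1))` or `(x, y) = (n·A (j+1), n·A j)`
((H5) at `x`, then (H4) at the neighbour `n⁻¹ · y` of `A j`). [cite: BruhatTits1972, §10] [cite: Serre1980Trees, II.1.1] -/
theorem exists_mem_unipotentU_latticeGraphIso_apartmentEnum_eq_of_adj {x y : {M : Submodule 𝒪[K] (Fin 3 → K) // IsVertex σ ϖ ((StdForm.antidiagonal 3).over K) M}}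
    (hxy : (latticeGraph σ ϖ ((StdForm.antidiagonal 3).over K)).Adj x y) :
    ∃ n : unitaryGroupOfForm σ ((StdForm.antidiagonal 3).over K), n ∈ unipotentU σ ((StdForm.antidiagonal 3).over K) ∧ ∃ j : ℤ,
      (latticeGraphIso σ ϖ ((StdForm.antidiagonal 3).over K) n (A j) = x ∧ latticeGraphIso σ ϖ ((StdForm.antidiagonal 3).over K) n (A (j + 1)) = y) ∨
      (latticeGraphIso σ ϖ ((StdForm.antidiagonal 3).over K) n (A (j + 1)) = x ∧ latticeGraphIso σ ϖ ((StdForm.antidiagonal 3).over K) n (A j) = y) := by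
  obtain ⟨n, hn, j, hj⟩ := exists_mem_unipotentU_latticeGraphIso_apartmentEnum_eq hd A hA0 hA1 x
  have hadj : (latticeGraph σ ϖ ((StdForm.antidiagonal 3).over K)).Adj (A j) (latticeGraphIso σ ϖ ((StdForm.antidiagonal 3).over K) n⁻¹ y) := by
    have := ((latticeGraphIso σ ϖ ((StdForm.antidiagonal 3).over K) n⁻¹).map_adj_iff).2 hxy
    rwa [← hj, latticeGraphIso_inv_mul_apply] at this
  rcases eq_apartmentEnum_sub_one_or_exists_mem_unipotentU_of_adj hd A hA0 hA1 j hadj with hy | ⟨n', hn', hn'j, hn'y⟩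
  · refine ⟨n, hn, j - 1, Or.inr ⟨?_, ?_⟩⟩
    · rw [sub_add_cancel, hj]
    · rw [← hy, latticeGraphIso_mul_inv_apply]
  · refine ⟨n * n', mul_mem hn hn', j, Or.inl ⟨?_, ?_⟩⟩
    · rw [latticeGraphIso_mul_apply, hn'j, hj]
    · rw [latticeGraphIso_mul_apply, hn'y, latticeGraphIso_mul_inv_apply]

/-- **(H7s) `Sym2` form**: `s(x, y) = n · s(A j, A (j+1))` for some `n ∈ N`, `j ∈ ℤ`. [cite: BruhatTits1972, §10] [cite: Serre1980Trees, II.1.1] -/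
theorem exists_mem_unipotentU_sym2Map_apartmentEnum_eq_of_adj {x y : {M : Submodule 𝒪[K] (Fin 3 → K) // IsVertex σ ϖ ((StdForm.antidiagonal 3).over K) M}}
    (hxy : (latticeGraph σ ϖ ((StdForm.antidiagonal 3).over K)).Adj x y) :
    ∃ n : unitaryGroupOfForm σ ((StdForm.antidiagonal 3).over K), n ∈ unipotentU σ ((StdForm.antidiagonal 3).over K) ∧ ∃ j : ℤ,
      Sym2.map (latticeGraphIso σ ϖ ((StdForm.antidiagonal 3).over K) n) s(A j, A (j + 1)) = s(x, y) := by
  obtain ⟨n, hn, j, h⟩ := exists_mem_unipotentU_latticeGraphIso_apartmentEnum_eq_of_adj hd A hA0 hA1 hxy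
  refine ⟨n, hn, j, ?_⟩
  rw [Sym2.map_mk, Sym2.eq_iff]
  rcases h with ⟨h1, h2⟩ | ⟨h1, h2⟩
  · exact Or.inl ⟨h1, h2⟩
  · exact Or.inr ⟨h2, h1⟩

/-- **(H7e) `edgeSet` form** (the consumers' currency `act₁ g := (latticeGraphIso … g).mapEdgeSet`): every edge is the image of an apartment edge
`⟨s(A j, A (j+1)), _⟩` under some `n ∈ N`. [cite: BruhatTits1972, §10] [cite: Serre1980Trees, II.1.1] -/
theorem exists_mem_unipotentU_mapEdgeSet_apartmentEnum_eq (e : (latticeGraph σ ϖ ((StdForm.antidiagonal 3).over K)).edgeSet) :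
    ∃ n : unitaryGroupOfForm σ ((StdForm.antidiagonal 3).over K), n ∈ unipotentU σ ((StdForm.antidiagonal 3).over K) ∧ ∃ j : ℤ,
      (latticeGraphIso σ ϖ ((StdForm.antidiagonal 3).over K) n).mapEdgeSet
          ⟨s(A j, A (j + 1)), (mem_edgeSet _).2 (latticeGraph_adj_apartmentEnum_succ hd A hA0 hA1 j)⟩ = e := by
  obtain ⟨e, he⟩ := e
  induction e using Sym2.ind with
  | h x y =>
    obtain ⟨n, hn, j, h⟩ := exists_mem_unipotentU_sym2Map_apartmentEnum_eq_of_adj hd A hA0 hA1 ((mem_edgeSet _).1 he)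
    exact ⟨n, hn, j, Subtype.ext h⟩

/-- **(H7!) THE APARTMENT INDEX OF AN EDGE IS WELL DEFINED**: `n · s(A i, A (i+1)) = s(A j, A (j+1))` with `n ∈ N` forces `i = j` ((H6) on both ends; the crossed
matching would give `i = j + 1` and `i + 1 = j`). [cite: BruhatTits1972, §10] [cite: Serre1980Trees, II.1.1] -/
theorem eq_of_mem_unipotentU_of_sym2Map_apartmentEnum_eq {n : unitaryGroupOfForm σ ((StdForm.antidiagonal 3).over K)}
    (hn : n ∈ unipotentU σ ((StdForm.antidiagonal 3).over K)) {i j : ℤ}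
    (h : Sym2.map (latticeGraphIso σ ϖ ((StdForm.antidiagonal 3).over K) n) s(A i, A (i + 1)) = s(A j, A (j + 1))) : i = j := by
  rw [Sym2.map_mk, Sym2.eq_iff] at h
  rcases h with ⟨h1, -⟩ | ⟨h1, h2⟩
  · exact eq_of_mem_unipotentU_of_latticeGraphIso_apartmentEnum_eq hd A hA0 hA1 hn h1
  · have e1 := eq_of_mem_unipotentU_of_latticeGraphIso_apartmentEnum_eq hd A hA0 hA1 hn h1
    have e2 := eq_of_mem_unipotentU_of_latticeGraphIso_apartmentEnum_eq hd A hA0 hA1 hn h2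
    omega

/-- **(H7!₂) two-element form**: `n · s(A i, A (i+1)) = n′ · s(A j, A (j+1))` with `n, n′ ∈ N` forces `i = j`. [cite: BruhatTits1972, §10] [cite: Serre1980Trees, II.1.1] -/
theorem eq_of_mem_unipotentU_of_sym2Map_apartmentEnum_eq₂ {n n' : unitaryGroupOfForm σ ((StdForm.antidiagonal 3).over K)}
    (hn : n ∈ unipotentU σ ((StdForm.antidiagonal 3).over K)) (hn' : n' ∈ unipotentU σ ((StdForm.antidiagonal 3).over K)) {i j : ℤ}
    (h : Sym2.map (latticeGraphIso σ ϖ ((StdForm.antidiagonal 3).over K) n) s(A i, A (i + 1)) =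
      Sym2.map (latticeGraphIso σ ϖ ((StdForm.antidiagonal 3).over K) n') s(A j, A (j + 1))) : i = j := by
  refine eq_of_mem_unipotentU_of_sym2Map_apartmentEnum_eq hd A hA0 hA1 (n := n'⁻¹ * n) (mul_mem (inv_mem hn') hn) ?_
  have h' := congrArg (Sym2.map (latticeGraphIso σ ϖ ((StdForm.antidiagonal 3).over K) n'⁻¹)) h
  rw [Sym2.map_map, Sym2.map_map, Sym2.map_mk, Sym2.map_mk] at h'
  simp only [Function.comp_apply, latticeGraphIso_inv_mul_apply] at h'
  rw [Sym2.map_mk, latticeGraphIso_mul_apply, latticeGraphIso_mul_apply]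
  exact h'

/-- **(H7!e) `edgeSet` form of the uniqueness.** [cite: BruhatTits1972, §10] [cite: Serre1980Trees, II.1.1] -/
theorem eq_of_mem_unipotentU_of_mapEdgeSet_apartmentEnum_eq {n n' : unitaryGroupOfForm σ ((StdForm.antidiagonal 3).over K)}
    (hn : n ∈ unipotentU σ ((StdForm.antidiagonal 3).over K)) (hn' : n' ∈ unipotentU σ ((StdForm.antidiagonal 3).over K)) {i j : ℤ}
    (h : (latticeGraphIso σ ϖ ((StdForm.antidiagonal 3).over K) n).mapEdgeSet
        ⟨s(A i, A (i + 1)), (mem_edgeSet _).2 (latticeGraph_adj_apartmentEnum_succ hd A hA0 hA1 i)⟩ =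
      (latticeGraphIso σ ϖ ((StdForm.antidiagonal 3).over K) n').mapEdgeSet
        ⟨s(A j, A (j + 1)), (mem_edgeSet _).2 (latticeGraph_adj_apartmentEnum_succ hd A hA0 hA1 j)⟩) : i = j :=
  eq_of_mem_unipotentU_of_sym2Map_apartmentEnum_eq₂ hd A hA0 hA1 hn hn' (congrArg Subtype.val h)

/-! ## §4 (H8) BOREL ELEMENTS: torus normal form on the apartment, stabilisers, and `B`-orbits = height fibres -/

/-- **(H8₀) TORUS NORMAL FORM ON THE APARTMENT**: every `t ∈ T` is `diag(d₀, d₁, d₂)` with `|d₀| = exp(−c)`, `|d₁| = 1`, `|d₂| = exp c` for some `c : ℤ`, and translates the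
apartment by `2c`: `t · A k = A (k + 2c)` (★ `mem_torusOfForm_iff`: `σ(d_{rev i}) d_i = 1`, `σ` valuation-preserving; `t = t_{−c}⁻¹ · s` with `s = t_{−c} t` unit-diagonal,
which fixes the apartment pointwise by (T′), and `t_{−c}` translating by `−2c` by (T)). [cite: BruhatTits1972, §10] [cite: Serre1980Trees, II.1.1; I.6.4] -/
theorem exists_forall_latticeGraphIso_apartmentEnum_eq_add_of_mem_torusU {t : unitaryGroupOfForm σ ((StdForm.antidiagonal 3).over K)}
    (ht : t ∈ torusU σ ((StdForm.antidiagonal 3).over K)) :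
    ∃ c : ℤ, (∀ k : ℤ, latticeGraphIso σ ϖ ((StdForm.antidiagonal 3).over K) t (A k) = A (k + 2 * c)) ∧
      ∃ d : Fin 3 → Kˣ, glDiagonal 3 K d = (t : GL (Fin 3) K) ∧
        Valued.v (d 0 : K) = WithZero.exp (-c) ∧ Valued.v (d 1 : K) = 1 ∧ Valued.v (d 2 : K) = WithZero.exp c := by
  obtain ⟨d, hdrel, hdt⟩ := mem_torusOfForm_iff.1 ((mem_torusU_iff_mem_torusOfForm rfl t).1 ht)
  have hvz : ∀ a : ℤ, Valued.v (ϖ ^ a) = WithZero.exp (-a) := fun a => by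
    rw [map_zpow₀, hd.vϖ, ← WithZero.exp_zsmul, smul_eq_mul, mul_neg, mul_one]
  -- valuations of the entries
  have h0ne : Valued.v (d 0 : K) ≠ 0 := (Valuation.ne_zero_iff _).2 (d 0).ne_zero
  set c : ℤ := -WithZero.log (Valued.v (d 0 : K)) with hc
  have hv0 : Valued.v (d 0 : K) = WithZero.exp (-c) := by
    rw [hc, neg_neg, WithZero.exp_log h0ne]
  have hv1 : Valued.v (d 1 : K) = 1 := by
    have h := congrArg Valued.v (hdrel 1)
    rw [map_mul, map_one, hd.vσ, show Fin.rev (1 : Fin 3) = 1 from rfl] at h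
    -- `x * x = 1` in `ℤᵐ⁰`: `x = exp a` with `a + a = 0`
    have h1ne : Valued.v (d 1 : K) ≠ 0 := (Valuation.ne_zero_iff _).2 (d 1).ne_zero
    rw [← WithZero.exp_log h1ne, ← WithZero.exp_add, WithZero.exp_eq_one] at h
    rw [← WithZero.exp_log h1ne, show WithZero.log (Valued.v (d 1 : K)) = 0 by omega, WithZero.exp_zero]
  have hv2 : Valued.v (d 2 : K) = WithZero.exp c := by
    have h := congrArg Valued.v (hdrel 0)
    rw [map_mul, map_one, hd.vσ, show Fin.rev (0 : Fin 3) = 2 from rfl, hv0] at h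
    -- `v(d 2) * exp(-c) = 1`
    have : Valued.v (d 2 : K) = (WithZero.exp (-c))⁻¹ := eq_inv_of_mul_eq_one_left h
    rw [this, WithZero.exp_neg, inv_inv]
  -- the translation `t_{-c}` and the unit-diagonal `s = t_{-c} * t`
  obtain ⟨t', ht'T, ht'mat, ht'A⟩ := exists_mem_torusU_latticeGraphIso_apartmentEnum_eq_add hd A hA0 hA1 (-c)
  have hsmat : (((t' * t : unitaryGroupOfForm σ ((StdForm.antidiagonal 3).over K)) : GL (Fin 3) K) : Matrix (Fin 3) (Fin 3) K) =
      Matrix.diagonal ![ϖ ^ (-c) * (d 0 : K), 1 * (d 1 : K), ϖ ^ c * (d 2 : K)] := by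
    rw [Subgroup.coe_mul, Units.val_mul, ht'mat, ← hdt, coe_glDiagonal, neg_neg]
    rw [show (Matrix.diagonal fun k => ((d k : Kˣ) : K)) = Matrix.diagonal ![(d 0 : K), (d 1 : K), (d 2 : K)] from by
      congr 1; funext k; fin_cases k <;> rfl]
    exact diagonal_three_mul _ _ _ _ _ _
  have hsu : Valued.v (ϖ ^ (-c) * (d 0 : K)) = 1 := by
    rw [map_mul, hvz, hv0, neg_neg, ← WithZero.exp_add, add_neg_cancel, WithZero.exp_zero]
  have hss : Valued.v (1 * (d 1 : K)) = 1 := by rw [one_mul, hv1]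
  have hsw : Valued.v (ϖ ^ c * (d 2 : K)) = 1 := by
    rw [map_mul, hvz, hv2, ← WithZero.exp_add, neg_add_cancel, WithZero.exp_zero]
  have hsfix := latticeGraphIso_apartmentEnum_eq_self_of_unit_diagonal hd A hA0 hA1 (t' * t) _ _ _ hsmat hsu hss hsw
  refine ⟨c, fun k => ?_, d, hdt, hv0, hv1, hv2⟩
  -- `t · A k = t'⁻¹ · (s · A k) = t'⁻¹ · A k = A (k + 2c)` since `t' · A (k + 2c) = A k`
  have h1 : latticeGraphIso σ ϖ ((StdForm.antidiagonal 3).over K) t (A k) =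
      latticeGraphIso σ ϖ ((StdForm.antidiagonal 3).over K) t'⁻¹ (latticeGraphIso σ ϖ ((StdForm.antidiagonal 3).over K) (t' * t) (A k)) := by
    rw [latticeGraphIso_mul_apply, latticeGraphIso_inv_mul_apply]
  have h2 : latticeGraphIso σ ϖ ((StdForm.antidiagonal 3).over K) t' (A (k + 2 * c)) = A k := by
    rw [ht'A]; congr 1; ring
  rw [h1, hsfix k, ← h2, latticeGraphIso_inv_mul_apply]

omit hd hA0 hA1 in
/-- A diagonal element of `U(σ, J₀)` whose entries are units lies in `K₀ = U ∩ GL₃(𝒪)` (★ `unitaryInt`: the entries of `diag(d)` and of `diag(d)⁻¹ = diag(d⁻¹)` are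
integral). [cite: BruhatTits1972, §10] -/
theorem mem_unitaryInt_of_glDiagonal_eq_of_v_eq_one {t : unitaryGroupOfForm σ ((StdForm.antidiagonal 3).over K)} {d : Fin 3 → Kˣ}
    (hdt : glDiagonal 3 K d = (t : GL (Fin 3) K)) (hv : ∀ i, Valued.v (d i : K) = 1) :
    t ∈ unitaryInt σ ((StdForm.antidiagonal 3).over K) := by
  rw [mem_unitaryInt_iff, ← hdt, ← map_inv, coe_glDiagonal, coe_glDiagonal]
  refine ⟨fun i j => ?_, fun i j => ?_⟩
  · by_cases hij : i = j
    · subst hij; rw [Matrix.diagonal_apply_eq, hv]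
    · rw [Matrix.diagonal_apply_ne _ hij, map_zero]; exact zero_le
  · by_cases hij : i = j
    · subst hij; rw [Matrix.diagonal_apply_eq, Pi.inv_apply, Units.val_inv_eq_inv_val, map_inv₀, hv, inv_one]
    · rw [Matrix.diagonal_apply_ne _ hij, map_zero]; exact zero_le

/-- **(H8) BOREL STABILISERS: `B ∩ Stab(A j) = C · (N ∩ Stab(A j))`** with `C` the unit-diagonal torus, in ∃-currency: a `b ∈ B` fixing `A j` is `b = t · n` with `t ∈ T`
unit-diagonal (hence in `K₀ = unitaryInt` and fixing EVERY apartment vertex) and `n ∈ N` fixing `A j` (★ `isComplement'_torusU_unipotentU`: `b = t n`; (H8₀): `n · A j = A (j − 2c)`; (H6): `c = 0`).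
[cite: BruhatTits1972, §10] [cite: Serre1980Trees, II.1.1; I.6.4] -/
theorem exists_torusU_mul_unipotentU_of_mem_borelU_of_latticeGraphIso_apartmentEnum_eq {b : unitaryGroupOfForm σ ((StdForm.antidiagonal 3).over K)}
    (hb : b ∈ borelU σ ((StdForm.antidiagonal 3).over K)) {j : ℤ} (h : latticeGraphIso σ ϖ ((StdForm.antidiagonal 3).over K) b (A j) = A j) :
    ∃ t n : unitaryGroupOfForm σ ((StdForm.antidiagonal 3).over K), t ∈ torusU σ ((StdForm.antidiagonal 3).over K) ∧
      t ∈ unitaryInt σ ((StdForm.antidiagonal 3).over K) ∧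
      n ∈ unipotentU σ ((StdForm.antidiagonal 3).over K) ∧ b = t * n ∧
      (∃ d : Fin 3 → Kˣ, glDiagonal 3 K d = (t : GL (Fin 3) K) ∧ ∀ i, Valued.v (d i : K) = 1) ∧
      (∀ k : ℤ, latticeGraphIso σ ϖ ((StdForm.antidiagonal 3).over K) t (A k) = A k) ∧
      latticeGraphIso σ ϖ ((StdForm.antidiagonal 3).over K) n (A j) = A j := by
  obtain ⟨⟨⟨t, htT⟩, ⟨n, hnN⟩⟩, htn, -⟩ :=
    (Subgroup.isComplement'_def.1 (isComplement'_torusU_unipotentU σ ((StdForm.antidiagonal 3).over K) rfl)).existsUnique ⟨b, hb⟩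
  have htT' : (t : unitaryGroupOfForm σ ((StdForm.antidiagonal 3).over K)) ∈ torusU σ ((StdForm.antidiagonal 3).over K) := Subgroup.mem_subgroupOf.1 htT
  have hnN' : (n : unitaryGroupOfForm σ ((StdForm.antidiagonal 3).over K)) ∈ unipotentU σ ((StdForm.antidiagonal 3).over K) := Subgroup.mem_subgroupOf.1 hnN
  have hbtn : b = (t : unitaryGroupOfForm σ ((StdForm.antidiagonal 3).over K)) * n := by
    have := congrArg Subtype.val htn
    exact this.symm
  obtain ⟨c, htA, d, hdt, hv0, hv1, hv2⟩ := exists_forall_latticeGraphIso_apartmentEnum_eq_add_of_mem_torusU hd A hA0 hA1 htT'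
  -- `n · A j = A (j - 2c)`
  have hnA : latticeGraphIso σ ϖ ((StdForm.antidiagonal 3).over K) n (A j) = A (j - 2 * c) := by
    have h1 : latticeGraphIso σ ϖ ((StdForm.antidiagonal 3).over K) (t : unitaryGroupOfForm σ ((StdForm.antidiagonal 3).over K))
        (latticeGraphIso σ ϖ ((StdForm.antidiagonal 3).over K) n (A j)) = A j := by
      rw [← latticeGraphIso_mul_apply, ← hbtn, h]
    have h2 : latticeGraphIso σ ϖ ((StdForm.antidiagonal 3).over K) (t : unitaryGroupOfForm σ ((StdForm.antidiagonal 3).over K)) (A (j - 2 * c)) = A j := by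
      rw [htA]; congr 1; ring
    exact (latticeGraphIso σ ϖ ((StdForm.antidiagonal 3).over K) (t : unitaryGroupOfForm σ ((StdForm.antidiagonal 3).over K))).injective (h1.trans h2.symm)
  have hc : c = 0 := by
    have := eq_of_mem_unipotentU_of_latticeGraphIso_apartmentEnum_eq hd A hA0 hA1 hnN' hnA
    omega
  subst hc
  have hv : ∀ i, Valued.v (d i : K) = 1 := by
    intro i
    fin_cases i
    · simpa using hv0
    · exact hv1
    · simpa using hv2
  refine ⟨t, n, htT', mem_unitaryInt_of_glDiagonal_eq_of_v_eq_one hdt hv, hnN', hbtn, ⟨d, hdt, hv⟩, fun k => ?_, ?_⟩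
  · rw [htA]; congr 1; ring
  · rw [hnA]; congr 1; ring

/-- **(H8′) `B`-ORBITS ARE HEIGHT FIBRES**: for `b ∈ B`, `b · A j = n · A (j + 2c)` for some `n ∈ N`, `c ∈ ℤ` (`b = t n = (t n t⁻¹) t`, ★ `borelU_le_normalizer`, (H8₀)); so
`B · A j = ⋃_c N · A (j + 2c)`. [cite: BruhatTits1972, §10] [cite: Serre1980Trees, II.1.1; I.6.4] -/
theorem exists_mem_unipotentU_latticeGraphIso_apartmentEnum_eq_of_mem_borelU {b : unitaryGroupOfForm σ ((StdForm.antidiagonal 3).over K)}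
    (hb : b ∈ borelU σ ((StdForm.antidiagonal 3).over K)) (j : ℤ) :
    ∃ n : unitaryGroupOfForm σ ((StdForm.antidiagonal 3).over K), n ∈ unipotentU σ ((StdForm.antidiagonal 3).over K) ∧ ∃ c : ℤ,
      latticeGraphIso σ ϖ ((StdForm.antidiagonal 3).over K) b (A j) = latticeGraphIso σ ϖ ((StdForm.antidiagonal 3).over K) n (A (j + 2 * c)) := by
  obtain ⟨⟨⟨t, htT⟩, ⟨n, hnN⟩⟩, htn, -⟩ :=
    (Subgroup.isComplement'_def.1 (isComplement'_torusU_unipotentU σ ((StdForm.antidiagonal 3).over K) rfl)).existsUnique ⟨b, hb⟩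
  have htT' : (t : unitaryGroupOfForm σ ((StdForm.antidiagonal 3).over K)) ∈ torusU σ ((StdForm.antidiagonal 3).over K) := Subgroup.mem_subgroupOf.1 htT
  have hnN' : (n : unitaryGroupOfForm σ ((StdForm.antidiagonal 3).over K)) ∈ unipotentU σ ((StdForm.antidiagonal 3).over K) := Subgroup.mem_subgroupOf.1 hnN
  have hbtn : b = (t : unitaryGroupOfForm σ ((StdForm.antidiagonal 3).over K)) * n := by
    have := congrArg Subtype.val htn
    exact this.symm
  obtain ⟨c, htA, -⟩ := exists_forall_latticeGraphIso_apartmentEnum_eq_add_of_mem_torusU hd A hA0 hA1 htT'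
  -- `n' := t n t⁻¹ ∈ N`
  have hn' : (t : unitaryGroupOfForm σ ((StdForm.antidiagonal 3).over K)) * n * (t : unitaryGroupOfForm σ ((StdForm.antidiagonal 3).over K))⁻¹ ∈
      unipotentU σ ((StdForm.antidiagonal 3).over K) :=
    (Subgroup.mem_normalizer_iff.1 (borelU_le_normalizer σ ((StdForm.antidiagonal 3).over K) t.2) n).1 hnN'
  refine ⟨_, hn', c, ?_⟩
  rw [hbtn, latticeGraphIso_mul_apply, latticeGraphIso_mul_apply, latticeGraphIso_mul_apply, ← htA j, latticeGraphIso_inv_mul_apply]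

end Enum

end Literature.NumberTheory.Automorphic.UnitaryLatticeTree

end
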